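import Summits.BirchSwinnertonDyer.BirchSwinnertonDyer.Theorems.ErratumRoadFiveTateTorsionRigidityPadicModel
import Summits.BirchSwinnertonDyer.BirchSwinnertonDyer.Theorems.ErratumRoadFiveBigRepLocalInvariants
import Summits.BirchSwinnertonDyer.BirchSwinnertonDyer.Theorems.ErratumRoadFiveAnticyclotomicLocalImage
import Summits.BirchSwinnertonDyer.Rank1Residual.X11b.AnticyclotomicEmbedding
import Literature.NumberTheory.EllipticCurves.PrimaryTorsionGaloisRep
import Literature.NumberTheory.EllipticCurves.BigGaloisRepSelmer
import Summits.BirchSwinnertonDyer.BirchSwinnertonDyer.Theorems.ErratumRoadFiveBigRepRationalTorsion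
import HarnessLib

/-!
# Route `ErratumRoadFive` (K2, `p ≥ 5`), crux (T) `Rest3TorsionBranchAtFive` (item
# stmt-BirchSwinnertonDyer-19702): OBJECT (O2′) OF THEOREM T♭ DISCHARGED — the local–global torsion
# comparison at a DEGREE-ONE prime `𝔭 ∣ p`, and with it the `f`-SIDE LOCAL HYPOTHESES of the
# Selmer-level assembly (`[Finite M_f^{Γ_𝔭}]`, `hkillf`, `hBf` of `SelmerDefectAssemblyMixed…`) for
# `M_f = T_pE ⊗ Λ^*` of the curve itself: `H⁰(K_𝔭, M_E)` is FINITE and killed by `p^k` (memo §31.2 (E))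

Cell `bsd-stepL` (run/shared/lean/pub/bsd-stepL/), seat `bsd-stepL-bdp` (prover g16, 2026-08-27), memo
`HOME/proof/PROOF-BDP.md` §31.2 (E), §33.9–§33.13; `--supports stmt-BirchSwinnertonDyer-19702 --as helper`.

WHAT. `E = W/ℚ` elliptic with SPLIT multiplicative reduction at the odd prime `p` (on branch (T) forced
by the non-zero `p`-torsion point of `E(ℚ_p)`), `K` a number field, `𝔭 ∋ p` a prime of `K` of DEGREE
ONE (`e = f = 1`: `K_𝔭 = ℚ_p`; automatic for `p` split in an imaginary quadratic `K`, tree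
`degreeOne_of_splitsIn`), `res = absGaloisRestrict K K_𝔭 : Γ_{K_𝔭} → Γ_K` (defn-ty1's
`BigGaloisRep.localMap K (Sum.inl 𝔭)`, by `rfl`), `f : Γ_{K_𝔭} → ℤ_p` continuous with image `⊇ p^s ℤ_p`
(the anticyclotomic character on the decomposition group, (O3) = g15's
`anticyclotomic_exists_forall_exists_toAdd_eq_pow_mul`).

* §1 `nonempty_padic_ringEquiv_adicCompletion` — `ℚ_p ≃+* K_𝔭` at a degree-one prime (tree
  `adicCompletionEquivOfDegreeOne` ∘ Mathlib `Padic.adicCompletionEquiv`, as multr1's `embAt`).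
* §2 `exists_pow_smul_eq_zero_and_finite_of_fixed` — for ANY `K`-field `F` with a ring isomorphism
  `ℚ_p ≃+* F`: the `res(ker f)`-fixed `p`-power-torsion points of `E(K̄)` are killed by ONE `p^k` and form
  a FINITE set of at most `p^k` elements (push along the chosen embedding `K̄ → F̄` —
  `pointsMapOfEmb`, equivariant for `res` — read in `E_F(F̄)`, `(E_K)_F = E_F`, and apply the companion's
  `padicModel_exists_generator_fixed_torsion`).
* §3 `exists_submodule_finite_of_fixed_primaryTorsion` — the same in the currency of p483100
  (`BigRepLocalInvariants`): for `A = E_K[p^∞]` (`PrimaryTorsion (geomPoints (W.baseChange K)) p`,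
  `ρ_E = primaryTorsionGaloisRep`) there are `k` and a FINITE `ℤ_p`-submodule `A₀` containing every
  `a` fixed by `res h` for all `h` with `f h = 1`, each such `a` being killed by `(p : ℤ_p)^k` — the
  inputs `hA₀` ∕ `hc` (object (O2) of memo §33.9 for the curve).
* §4 **`tFlat_fLocal_of_degreeOne`** — for `M_f = (W.baseChange K).anticyclotomicBigRep p κ` restricted
  along `localMap K (Sum.inl 𝔭)`: `H⁰(Γ_{K_𝔭}, M_f)` is FINITE, of order `≤ B`, and killed by `(C p)^k`
  — VERBATIM the three `f`-side local hypotheses `[Finite …]` ∕ `hBf` ∕ `hkillf` of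
  `SelmerDefectAssemblyMixed.charIdeal_le_of_selmer_congruences_fLocal_printed_mixed` (p485416) and of
  `LocalInvariantsTransfer.charIdeal_le_of_selmer_congruences_fLocal_printed` (p483752) at `v₀ = Sum.inl 𝔭`,
  `a = C p`; **`tFlat_fLocal_anticyclotomic`** — the same with (O3) discharged (`K` imaginary quadratic,
  `κ` anticyclotomic); **`tFlat_fLocal_branchT`** — in the crux's binders (`Mult W p`, `3 ≤ p`, a non-zero
  `p`-torsion point of `E(ℚ_p)`, `p` split in `K`).

HONEST FRAMING: theorems only (no definition, no named fact, no `sorry`), FACT-FREE (Tate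
uniformisation, Krasner-free field theory, Brink's Cor. 1 — all tree theorems). This discharges the LAST
E-side object of T♭'s instantiation layer named by g15 ((O2′), STATUS 02:25Z); what remains for the
(T)-branch instantiation of `…_fLocal_printed_mixed` is road-wide and shared with 19270's exact road:
(O1) the Selmer identification `Sel_{𝔭bar}(K_∞, E[p^∞])^∨ ≅ X(selmer (localMap K) (strictSet p 𝔭 Σ) M_f)`
(defn-ty1's F1 ∕ Σ-bridge, at the CORRECT prime per the orientation audit) and the erratum's analytic ∕
Hida-family binders ((a)–(c), [Hsi14], the `g_m`, their Selmer modules and `θ_m`). Nothing is booked; no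
census word, tier or label moves (T7); the road's grade (PRE via FW21 4.41) is unchanged.

References: [Castella2018Erratum] Lemma 2.1, Remark (2), proof of Thm. 1.1 (pp. 2–4);
[Castella2018] §2.1–2.2 («`𝒜 = T ⊗ Λ^*`», «`K_𝔭 = ℚ_p`»); [SkinnerUrban2014] Prop. 3.2.3;
[SilvermanATAEC1994] Thm. V.5.3; [FrohlichTaylor1990] Ch. III §1 (1.14)(a); memo PROOF-BDP §31.2 (E),
§33.9–§33.13.
-/

set_option autoImplicit false
-- the Theorems namespace of this sub repeats the summit name by design (D-0017 nested layout)
set_option linter.dupNamespace false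

noncomputable section

open scoped Classical

namespace Summit.BirchSwinnertonDyer.BirchSwinnertonDyer.Theorems.LocalTorsionDegreeOne

open Field WeierstrassCurve NumberField IsDedekindDomain
  Literature.NumberTheory.GaloisRepresentations Literature.NumberTheory.EllipticCurves
  Literature.NumberTheory.EllipticCurves.BigRepModule
  Summit.BirchSwinnertonDyer.BirchSwinnertonDyer.Theorems.TateTorsionRigidity
  Summit.BirchSwinnertonDyer.Rank1Residual.X11b

universe u

/-! ### §1 `ℚ_p ≃+* K_𝔭` at a prime of degree one -/

/-- **`K_𝔭 = ℚ_p` at a degree-one prime `𝔭 ∣ p`** (`e(𝔭|p) = f(𝔭|p) = 1`): a ring isomorphism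
`ℚ_p ≃+* K_𝔭` — Mathlib's `Padic.adicCompletionEquiv : ℚ_[p] ≃ ℚ_v` followed by the tree's
`adicCompletionEquivOfDegreeOne ℚ K v 𝔭 : ℚ_v ≃+* K_𝔭` (`v` the place of `ℚ` at `p`); the `K_𝔭`-part of
multr1-p1's `embAt` and of imc-p1's `nonempty_ringHom_adicCompletion_padic`, as an isomorphism.
[cite: FrohlichTaylor1990, Ch. III §1 (1.14)(a)] [cite: Castella2018, §2.2 ("K_𝔭 = ℚ_p")] -/
theorem nonempty_padic_ringEquiv_adicCompletion (p : ℕ) [Fact p.Prime] (K : Type) [Field K] [NumberField K]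
    (𝔭 : HeightOneSpectrum (𝓞 K)) (h𝔭 : ((p : ℕ) : 𝓞 K) ∈ 𝔭.asIdeal)
    (he : 𝔭.asIdeal.ramificationIdx (𝓞 ℚ) = 1) (hf : 𝔭.asIdeal.inertiaDeg (𝓞 ℚ) = 1) :
    Nonempty (ℚ_[p] ≃+* 𝔭.adicCompletion K) := by
  haveI : 𝔭.asIdeal.LiesOver (ratPlace p).asIdeal := ⟨by rw [← under_eq_ratPlace_of_mem h𝔭]; rfl⟩
  exact ⟨(Padic.adicCompletionEquiv (𝓞 ℚ) ⟨p, Fact.out⟩).toAlgEquiv.toRingEquiv.trans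
    (Literature.NumberTheory.Automorphic.adicCompletionEquivOfDegreeOne ℚ K (ratPlace p) 𝔭 he hf)⟩

/-! ### §2 The `res(ker f)`-fixed `p`-power torsion of `E(K̄)` is killed by one `p^k` and finite -/

section Fixed

variable {p : ℕ} [Fact p.Prime] (W : WeierstrassCurve ℚ) [W.IsElliptic] (K F : Type) [Field K] [Field F]

/-- The chosen map on points `E_K(K̄) → (E_K)_F(F̄)` along `absClosureEmbedding K F` (the tree's
`pointsMapOfEmb`, read in the geometric points of the base-changed curve — the same type) is equivariant
for `absGaloisRestrict K F : Γ_F → Γ_K` (`res_ι = absGaloisRestrict` for the chosen `ι`, both being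
characterised by `ι (τ • x) = σ • ι x`; imc-p1 g8's `resGalOfEmb_absClosureEmbedding_eq` ∕
`smul_eq_smul_geomPoints`). [cite: SerreGaloisCohomology1997, II.§1.1 (restriction to a decomposition group)] -/
theorem pointsMapOfEmb_absGaloisRestrict_smul [Algebra K F] (W' : WeierstrassCurve K) (σ : absoluteGaloisGroup F)
    (P : W'.geomPoints) :
    @id (W'.baseChange F).geomPoints (pointsMapOfEmb W' (absClosureEmbedding K F) (absGaloisRestrict K F σ • P)) =
      σ • @id (W'.baseChange F).geomPoints (pointsMapOfEmb W' (absClosureEmbedding K F) P) := by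
  -- `res_ι = absGaloisRestrict` (imc-p1's `resGalOfEmb_absClosureEmbedding_eq`), equivariance of
  -- `pointsMapOfEmb`, and agreement of the two `Γ_F`-actions on `E(F̄)` (`smul_eq_smul_geomPoints`)
  rw [← BigRep.resGalOfEmb_absClosureEmbedding_eq F σ, pointsMapOfEmb_smul W' (absClosureEmbedding K F) σ P]
  exact BigRep.smul_eq_smul_geomPoints W' F σ _

variable [CharZero K] [CharZero F] [Algebra K F]

omit [W.IsElliptic] in
/-- **An injective `res`-equivariant map `E_K(K̄) → E(F̄)`** for `E = W/ℚ` and a `K`-field `F`: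
`g (res σ • P) = σ • g P` (`pointsMapOfEmb` along the chosen embedding, then `(E_K)_F = E_F`, Mathlib
`map_baseChange`). [cite: SerreGaloisCohomology1997, II.§1.1 (restriction to a decomposition group)] -/
theorem exists_addMonoidHom_geomPoints_absGaloisRestrict_smul :
    ∃ g : geomPoints (W.baseChange K) →+ geomPoints (W.baseChange F), Function.Injective g ∧
      ∀ (σ : absoluteGaloisGroup F) (P : geomPoints (W.baseChange K)),
        g (absGaloisRestrict K F σ • P) = σ • g P := by
  have hW : (W.baseChange K).baseChange F = W.baseChange F := W.map_baseChange (algebraMap K F).toRatAlgHom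
  obtain ⟨e, he⟩ := exists_addEquiv_geomPoints_smul_of_eq F hW
  let g₁ : geomPoints (W.baseChange K) →+ ((W.baseChange K).baseChange F).geomPoints :=
    pointsMapOfEmb (W.baseChange K) (absClosureEmbedding K F)
  refine ⟨e.toAddMonoidHom.comp g₁, e.injective.comp (pointsMapOfEmb_injective _ _), fun σ P => ?_⟩
  change e (@id ((W.baseChange K).baseChange F).geomPoints (pointsMapOfEmb (W.baseChange K)
    (absClosureEmbedding K F) (absGaloisRestrict K F σ • P))) = σ • e _
  rw [pointsMapOfEmb_absGaloisRestrict_smul K F (W.baseChange K) σ P, he]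
  rfl

/-- **(O2′): the `res(ker f)`-fixed `p`-power torsion of `E(K̄)` is killed by ONE `p^k` and FINITE.**
`p` odd, `E = W/ℚ` split multiplicative at `p`, `F` a `K`-field with a ring isomorphism `ℚ_p ≃+* F`
(`K_𝔭` at a degree-one `𝔭 ∣ p`), `f : Γ_F → ℤ_p` continuous with image `⊇ p^s ℤ_p`: there is `k`
(`= max{j : q_E ∈ (ℚ_p^×)^{p^j}}`) such that every `P ∈ E(K̄)` with `p^n P = O` fixed by `res τ` for all
`τ ∈ ker f` (`res = absGaloisRestrict K F`) satisfies `p^k P = O`, and these `P` form a finite set of at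
most `p^k` elements — «`E(K_{∞,w})[p^∞] = E(ℚ_p)[p^∞] ≅ ℤ/p^k`» seen from `K̄`.
[cite: Castella2018Erratum, Lemma 2.1 and Remark (2) (p. 2)] [cite: SilvermanATAEC1994, Thm. V.5.3 (PDF pp. 407–409)] -/
theorem exists_pow_smul_eq_zero_and_finite_of_fixed (hp2 : p ≠ 2)
    (hsplit : W.HasSplitMultiplicativeReductionAtPrime p) (φ : ℚ_[p] ≃+* F)
    (f : absoluteGaloisGroup F →ₜ* Multiplicative ℤ_[p]) {s : ℕ}
    (hsurj : ∀ y : ℤ_[p], ∃ σ : absoluteGaloisGroup F, (f σ).toAdd = (p : ℤ_[p]) ^ s * y) :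
    ∃ k : ℕ,
      (∀ (P : geomPoints (W.baseChange K)) (n : ℕ), (p ^ n) • P = 0 →
        (∀ τ ∈ f.toMonoidHom.ker, absGaloisRestrict K F τ • P = P) → (p ^ k) • P = 0) ∧
      {P : geomPoints (W.baseChange K) | (∃ n : ℕ, (p ^ n) • P = 0) ∧
        ∀ τ ∈ f.toMonoidHom.ker, absGaloisRestrict K F τ • P = P}.Finite ∧
      {P : geomPoints (W.baseChange K) | (∃ n : ℕ, (p ^ n) • P = 0) ∧
        ∀ τ ∈ f.toMonoidHom.ker, absGaloisRestrict K F τ • P = P}.ncard ≤ p ^ k := by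
  letI : Algebra ℚ_[p] F := φ.toRingHom.toAlgebra
  have hF : Function.Bijective (algebraMap ℚ_[p] F) := φ.bijective
  obtain ⟨k, P₀, -, hk, hord, hgen⟩ := padicModel_exists_generator_fixed_torsion hp2 W hsplit F hF f hsurj
  obtain ⟨g, hginj, hg⟩ := exists_addMonoidHom_geomPoints_absGaloisRestrict_smul W K F
  -- every fixed torsion point maps to a multiple of `P₀`
  have hmul : ∀ P : geomPoints (W.baseChange K), (∃ n : ℕ, (p ^ n) • P = 0) →
      (∀ τ ∈ f.toMonoidHom.ker, absGaloisRestrict K F τ • P = P) → ∃ j : ℤ, g P = j • P₀ := by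
    rintro P ⟨n, hn⟩ hfix
    exact hgen (g P) n (by rw [← map_nsmul, hn, map_zero]) fun τ hτ => by rw [← hg, hfix τ hτ]
  -- the order of `P₀` is `p^k`, so `zmultiples P₀` has `p^k` elements
  have hordP₀ : addOrderOf P₀ = p ^ k := by
    refine Nat.dvd_antisymm (addOrderOf_dvd_of_nsmul_eq_zero hk) (hord _ (addOrderOf_nsmul_eq_zero P₀))
  have hcardZ : Nat.card (AddSubgroup.zmultiples P₀) = p ^ k := by rw [Nat.card_zmultiples, hordP₀]
  have hfinZ : (AddSubgroup.zmultiples P₀ : Set (geomPoints (W.baseChange F))).Finite := by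
    have : Finite (AddSubgroup.zmultiples P₀) :=
      Nat.finite_of_card_ne_zero (by rw [hcardZ]; exact pow_ne_zero _ (Fact.out : p.Prime).ne_zero)
    exact Set.toFinite _
  set S := {P : geomPoints (W.baseChange K) | (∃ n : ℕ, (p ^ n) • P = 0) ∧
    ∀ τ ∈ f.toMonoidHom.ker, absGaloisRestrict K F τ • P = P} with hS
  have himg : g '' S ⊆ (AddSubgroup.zmultiples P₀ : Set (geomPoints (W.baseChange F))) := by
    rintro _ ⟨P, ⟨hP, hfix⟩, rfl⟩
    obtain ⟨j, hj⟩ := hmul P hP hfix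
    exact ⟨j, hj.symm⟩
  refine ⟨k, fun P n hn hfix => ?_, ?_, ?_⟩
  · obtain ⟨j, hj⟩ := hmul P ⟨n, hn⟩ hfix
    apply hginj
    rw [map_nsmul, map_zero, hj, smul_comm, hk, smul_zero]
  · exact (hfinZ.subset himg).of_finite_image hginj.injOn
  · calc S.ncard = (g '' S).ncard := (Set.ncard_image_of_injective S hginj).symm
      _ ≤ (AddSubgroup.zmultiples P₀ : Set (geomPoints (W.baseChange F))).ncard :=
          Set.ncard_le_ncard himg hfinZ
      _ = p ^ k := by rw [← Nat.card_coe_set_eq]; exact hcardZ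

/-! ### §3 The same in the currency of `BigRepLocalInvariants`: `A = E_K[p^∞]`, `ρ_E`, `hA₀` ∕ `hc` -/

/-- **(O2) for the curve — the inputs `hA₀` ∕ `hc` of p483100 (`BigRepLocalInvariants`).** For
`A = E_K[p^∞]` (`PrimaryTorsion (geomPoints (W.baseChange K)) p`, the carrier of
`ρ_E = (W.baseChange K).primaryTorsionGaloisRep p`), `F` a `K`-field with `ℚ_p ≃+* F` and
`f : Γ_F → ℤ_p` continuous with image `⊇ p^s ℤ_p`: there are `k` and a FINITE `ℤ_p`-submodule `A₀ ≤ A`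
with `#A₀ ≤ p^k` such that every `a ∈ A` fixed by `res h` for all `h ∈ Γ_F` with `f h = 1` lies in `A₀`
and is killed by `(p : ℤ_p)^k` — «`A^{ker} = E(K_{∞,w})[p^∞] = E(ℚ_p)[p^∞] ≅ ℤ/p^k`».
[cite: Castella2018Erratum, Lemma 2.1 (the defect H⁰(K_𝔭, M)/ϖ^m) and Remark (2) (p. 2)]
[cite: SilvermanATAEC1994, Thm. V.5.3 (PDF pp. 407–409)] -/
theorem exists_submodule_finite_of_fixed_primaryTorsion (hp2 : p ≠ 2)
    (hsplit : W.HasSplitMultiplicativeReductionAtPrime p) (φ : ℚ_[p] ≃+* F)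
    (f : absoluteGaloisGroup F →ₜ* Multiplicative ℤ_[p]) {s : ℕ}
    (hsurj : ∀ y : ℤ_[p], ∃ σ : absoluteGaloisGroup F, (f σ).toAdd = (p : ℤ_[p]) ^ s * y) :
    ∃ (k : ℕ) (A₀ : Submodule ℤ_[p] (PrimaryTorsion (geomPoints (W.baseChange K)) p)),
      Finite A₀ ∧ Nat.card A₀ ≤ p ^ k ∧
      (∀ a : PrimaryTorsion (geomPoints (W.baseChange K)) p,
        (∀ h : absoluteGaloisGroup F, f h = 1 → absGaloisRestrict K F h • a = a) → a ∈ A₀) ∧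
      ∀ a : PrimaryTorsion (geomPoints (W.baseChange K)) p,
        (∀ h : absoluteGaloisGroup F, f h = 1 → absGaloisRestrict K F h • a = a) →
          ((p : ℤ_[p]) ^ k) • a = 0 := by
  obtain ⟨k, hkill, hfin, hcard⟩ := exists_pow_smul_eq_zero_and_finite_of_fixed W K F hp2 hsplit φ f hsurj
  -- the submodule of `res(ker f)`-fixed vectors
  let A₀ : Submodule ℤ_[p] (PrimaryTorsion (geomPoints (W.baseChange K)) p) :=
    { carrier := {a | ∀ h : absoluteGaloisGroup F, f h = 1 → absGaloisRestrict K F h • a = a}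
      add_mem' := fun {a b} ha hb h hh => by rw [smul_add, ha h hh, hb h hh]
      zero_mem' := fun h _ => smul_zero _
      smul_mem' := fun c {a} ha h hh => by rw [smul_comm, ha h hh] }
  have hmem : ∀ a : PrimaryTorsion (geomPoints (W.baseChange K)) p,
      (∀ h : absoluteGaloisGroup F, f h = 1 → absGaloisRestrict K F h • a = a) → a ∈ A₀ := fun a ha => ha
  -- the underlying points of `A₀` lie in the finite set of §2
  have hval : ∀ a : A₀, ((a : PrimaryTorsion (geomPoints (W.baseChange K)) p) : geomPoints (W.baseChange K)) ∈
      {P : geomPoints (W.baseChange K) | (∃ n : ℕ, (p ^ n) • P = 0) ∧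
        ∀ τ ∈ f.toMonoidHom.ker, absGaloisRestrict K F τ • P = P} := fun a =>
    ⟨PrimaryTorsion.exists_pow_smul_eq_zero _, fun τ hτ => by
      have h := a.2 τ ((MonoidHom.mem_ker).1 hτ)
      exact congrArg PrimaryTorsion.val h⟩
  have hinj : Function.Injective fun a : A₀ =>
      (⟨_, hval a⟩ : {P : geomPoints (W.baseChange K) | (∃ n : ℕ, (p ^ n) • P = 0) ∧
        ∀ τ ∈ f.toMonoidHom.ker, absGaloisRestrict K F τ • P = P}) := by
    intro a b hab
    have h := congrArg Subtype.val hab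
    exact Subtype.ext (PrimaryTorsion.ext h)
  haveI : Finite {P : geomPoints (W.baseChange K) | (∃ n : ℕ, (p ^ n) • P = 0) ∧
      ∀ τ ∈ f.toMonoidHom.ker, absGaloisRestrict K F τ • P = P} := hfin.to_subtype
  haveI : Finite A₀ := Finite.of_injective _ hinj
  refine ⟨k, A₀, inferInstance, ?_, hmem, fun a ha => ?_⟩
  · calc Nat.card A₀ ≤ Nat.card {P : geomPoints (W.baseChange K) | (∃ n : ℕ, (p ^ n) • P = 0) ∧
          ∀ τ ∈ f.toMonoidHom.ker, absGaloisRestrict K F τ • P = P} := Nat.card_le_card_of_injective _ hinj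
      _ ≤ p ^ k := by rw [Nat.card_coe_set_eq]; exact hcard
  · obtain ⟨n, hn⟩ := PrimaryTorsion.exists_pow_smul_eq_zero a
    exact PrimaryTorsion.pow_smul_eq_zero_of a
      (hkill _ n hn fun τ hτ => congrArg PrimaryTorsion.val (ha τ ((MonoidHom.mem_ker).1 hτ)))

end Fixed

/-! ### §4 THEOREM T♭'s `f`-side local hypotheses for `M_f = T_pE_K ⊗ Λ^*` at a degree-one `𝔭` -/

section TFlat

variable {K : Type} [Field K] [NumberField K] (W : WeierstrassCurve ℚ) [W.IsElliptic]
  (p : ℕ) [Fact p.Prime] [TopologicalSpace (PowerSeries ℤ_[p])]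
  [ContinuousSMul (PowerSeries ℤ_[p]) (BigRepModule ℤ_[p] p (PrimaryTorsion (W.baseChange K).geomPoints p))]

/-- **THE `f`-SIDE LOCAL HYPOTHESES OF T♭'s SELMER-LEVEL ASSEMBLY, DISCHARGED FOR THE CURVE.** `p` odd,
`E = W/ℚ` split multiplicative at `p`, `K` a number field, `𝔭 ∋ p` of degree one, `κ` a `ℤ_p`-extension
of `K` whose character has OPEN image on the decomposition group at `𝔭` (`hsurj`, (O3)). Then for
`M_f = (W.baseChange K).anticyclotomicBigRep p κ` restricted along `localMap K (Sum.inl 𝔭) = res_{K_𝔭}`: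
**`H⁰(K_𝔭, M_f)` is FINITE, of order `≤ B`, and killed by `(C p)^k`** — verbatim `[Finite …]`, `hBf`,
`hkillf` (with `a = C p`, `j = k`) of `SelmerDefectAssemblyMixed.charIdeal_le_of_selmer_congruences_fLocal_printed_mixed`
and `LocalInvariantsTransfer.charIdeal_le_of_selmer_congruences_fLocal_printed` at `v₀ = Sum.inl 𝔭`.
Assembly: §3 (`hA₀`, `hc`) into p483100's Shapiro-in-the-co-induced-model
(`BigRepLocalInvariants.finite_invariants` ∕ `natCard_invariants_le` ∕ `C_pow_smul_eq_zero_of_mem_invariants`).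
[cite: Castella2018Erratum, Lemma 2.1 (the defect H⁰(K_𝔭, M_g)/ϖ^m) and Remark (2) (p. 2)]
[cite: SkinnerUrban2014, Prop. 3.2.3 (Shapiro, co-induced model)] -/
theorem tFlat_fLocal_of_degreeOne (hp2 : p ≠ 2) (hsplit : W.HasSplitMultiplicativeReductionAtPrime p)
    (𝔭 : HeightOneSpectrum (𝓞 K)) (h𝔭 : ((p : ℕ) : 𝓞 K) ∈ 𝔭.asIdeal)
    (he : 𝔭.asIdeal.ramificationIdx (𝓞 ℚ) = 1) (hf : 𝔭.asIdeal.inertiaDeg (𝓞 ℚ) = 1)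
    (κ : ZpExtension K p) {s : ℕ}
    (hsurj : ∀ y : ℤ_[p], ∃ τ : absoluteGaloisGroup (𝔭.adicCompletion K),
      (κ (absGaloisRestrict K (𝔭.adicCompletion K) τ)).toAdd = (p : ℤ_[p]) ^ s * y) :
    ∃ k B : ℕ,
      Finite ((((W.baseChange K).anticyclotomicBigRep p κ).restrict
        (BigGaloisRep.localMap K (Sum.inl 𝔭))).toTopRep).ρ.invariants ∧
      Nat.card ((((W.baseChange K).anticyclotomicBigRep p κ).restrict
        (BigGaloisRep.localMap K (Sum.inl 𝔭))).toTopRep).ρ.invariants ≤ B ∧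
      ∀ Φ ∈ ((((W.baseChange K).anticyclotomicBigRep p κ).restrict
        (BigGaloisRep.localMap K (Sum.inl 𝔭))).toTopRep).ρ.invariants,
        (PowerSeries.C (p : ℤ_[p]) : PowerSeries ℤ_[p]) ^ k • Φ = 0 := by
  haveI : CharZero (𝔭.adicCompletion K) :=
    charZero_of_injective_algebraMap (algebraMap K (𝔭.adicCompletion K)).injective
  obtain ⟨φ⟩ := nonempty_padic_ringEquiv_adicCompletion p K 𝔭 h𝔭 he hf
  let f : absoluteGaloisGroup (𝔭.adicCompletion K) →ₜ* Multiplicative ℤ_[p] :=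
    κ.toContinuousMonoidHom.comp (absGaloisRestrict K (𝔭.adicCompletion K))
  have hsurjf : ∀ y : ℤ_[p], ∃ τ : absoluteGaloisGroup (𝔭.adicCompletion K),
      (f τ).toAdd = (p : ℤ_[p]) ^ s * y := hsurj
  obtain ⟨k, A₀, hA₀fin, hA₀card, hA₀, hc⟩ :=
    exists_submodule_finite_of_fixed_primaryTorsion W K (𝔭.adicCompletion K) hp2 hsplit φ f hsurjf
  haveI := hA₀fin
  -- the restricted big representation is `bigRep (κ ∘ res) (ρ_E ∘ res)`
  have hA₀' : ∀ a : PrimaryTorsion (geomPoints (W.baseChange K)) p,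
      (∀ h : absoluteGaloisGroup (𝔭.adicCompletion K), f h = 1 →
        ((W.baseChange K).primaryTorsionGaloisRep p).restrict
          (BigGaloisRep.localMap K (Sum.inl 𝔭)) h a = a) → a ∈ A₀ := fun a ha =>
    hA₀ a fun h hh => by
      have h1 := ha h hh
      rw [ContinuousRep.restrict_apply, primaryTorsionGaloisRep_apply] at h1
      exact h1
  have hc' : ∀ a : PrimaryTorsion (geomPoints (W.baseChange K)) p,
      (∀ h : absoluteGaloisGroup (𝔭.adicCompletion K), f h = 1 →
        ((W.baseChange K).primaryTorsionGaloisRep p).restrict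
          (BigGaloisRep.localMap K (Sum.inl 𝔭)) h a = a) → (p : ℤ_[p]) ^ k • a = 0 := fun a ha =>
    hc a fun h hh => by
      have h1 := ha h hh
      rw [ContinuousRep.restrict_apply, primaryTorsionGaloisRep_apply] at h1
      exact h1
  rw [show ((W.baseChange K).anticyclotomicBigRep p κ).restrict (BigGaloisRep.localMap K (Sum.inl 𝔭)) =
      bigRep (p := p) f (((W.baseChange K).primaryTorsionGaloisRep p).restrict
        (BigGaloisRep.localMap K (Sum.inl 𝔭))) from bigRep_restrict _ _ _]
  refine ⟨k, Nat.card A₀ ^ (p ^ s), ?_, ?_, fun Φ hΦ => ?_⟩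
  · exact BigRepLocalInvariants.finite_invariants f _ hsurjf A₀ hA₀'
  · exact BigRepLocalInvariants.natCard_invariants_le f _ hsurjf A₀ hA₀'
  · exact BigRepLocalInvariants.C_pow_smul_eq_zero_of_mem_invariants f _ hc' Φ hΦ

/-- **T♭'s `f`-side local hypotheses on the ANTICYCLOTOMIC tower, (O3) discharged**: `K` imaginary
quadratic, `p` odd, `κ` anticyclotomic (open image on `Γ_{K_𝔭}` by g15's
`anticyclotomic_exists_forall_exists_toAdd_eq_pow_mul`, from the tree's Brink Cor. 1), `𝔭 ∋ p` of degree
one, `E = W/ℚ` split multiplicative at `p`: `H⁰(K_𝔭, M_f)` is finite, bounded, and killed by `(C p)^k`.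
[cite: Castella2018Erratum, Lemma 2.1 and Remark (2) (p. 2)] [cite: Brink2007, Cor. 1 (p. 2136)] -/
theorem tFlat_fLocal_anticyclotomic (hK : IsImaginaryQuadratic K) (hp2 : p ≠ 2)
    (hsplit : W.HasSplitMultiplicativeReductionAtPrime p)
    (𝔭 : HeightOneSpectrum (𝓞 K)) (h𝔭 : ((p : ℕ) : 𝓞 K) ∈ 𝔭.asIdeal)
    (he : 𝔭.asIdeal.ramificationIdx (𝓞 ℚ) = 1) (hf : 𝔭.asIdeal.inertiaDeg (𝓞 ℚ) = 1)
    (κ : ZpExtension K p) (hκ : κ.IsAnticyclotomic) :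
    ∃ k B : ℕ,
      Finite ((((W.baseChange K).anticyclotomicBigRep p κ).restrict
        (BigGaloisRep.localMap K (Sum.inl 𝔭))).toTopRep).ρ.invariants ∧
      Nat.card ((((W.baseChange K).anticyclotomicBigRep p κ).restrict
        (BigGaloisRep.localMap K (Sum.inl 𝔭))).toTopRep).ρ.invariants ≤ B ∧
      ∀ Φ ∈ ((((W.baseChange K).anticyclotomicBigRep p κ).restrict
        (BigGaloisRep.localMap K (Sum.inl 𝔭))).toTopRep).ρ.invariants,
        (PowerSeries.C (p : ℤ_[p]) : PowerSeries ℤ_[p]) ^ k • Φ = 0 := by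
  obtain ⟨s, hsurj⟩ :=
    AnticyclotomicLocalImage.anticyclotomic_exists_forall_exists_toAdd_eq_pow_mul hK hp2 κ hκ 𝔭 h𝔭
  exact tFlat_fLocal_of_degreeOne W p hp2 hsplit 𝔭 h𝔭 he hf κ hsurj

/-- **T♭'s `f`-side local hypotheses IN THE CRUX'S BINDERS (branch (T), item 19702)**: `E = W/ℚ`
globally minimal, multiplicative at `p ≥ 3` with a NON-ZERO `p`-torsion point in `E(ℚ_p)` (so SPLIT at
`p`, the cell's `LocalTorsion.split_and_dvd_of_localTorsion_ne_zero`), `K` imaginary quadratic with `p`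
SPLIT in `K` (every `𝔭 ∋ p` then has degree one, tree `degreeOne_of_splitsIn`), `κ` anticyclotomic: for
every prime `𝔭 ∋ p` of `K`, `H⁰(K_𝔭, M_f)` is finite, bounded, and killed by `(C p)^k` — the boundedness
input that replaces hypothesis (iv) «`E(ℚ_p)[p] = 0`» on these rows (memo §31.2 (E)).
[cite: Castella2018Erratum, Thm. 1.1 (iv), Lemma 2.1 and Remark (2) (pp. 1–2)] -/
theorem tFlat_fLocal_branchT [W.IsGloballyMinimal] (hK : IsImaginaryQuadratic K) (hp3 : 3 ≤ p)
    (hmult : Literature.NumberTheory.EllipticCurves.Rank1Residual.Mult W p)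
    (hT : ∃ P : (W.baseChange ℚ_[p]).toAffine.Point, p • P = 0 ∧ P ≠ 0)
    (hs : SplitsIn K p) (𝔭 : HeightOneSpectrum (𝓞 K)) (h𝔭 : ((p : ℕ) : 𝓞 K) ∈ 𝔭.asIdeal)
    (κ : ZpExtension K p) (hκ : κ.IsAnticyclotomic) :
    ∃ k B : ℕ,
      Finite ((((W.baseChange K).anticyclotomicBigRep p κ).restrict
        (BigGaloisRep.localMap K (Sum.inl 𝔭))).toTopRep).ρ.invariants ∧
      Nat.card ((((W.baseChange K).anticyclotomicBigRep p κ).restrict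
        (BigGaloisRep.localMap K (Sum.inl 𝔭))).toTopRep).ρ.invariants ≤ B ∧
      ∀ Φ ∈ ((((W.baseChange K).anticyclotomicBigRep p κ).restrict
        (BigGaloisRep.localMap K (Sum.inl 𝔭))).toTopRep).ρ.invariants,
        (PowerSeries.C (p : ℤ_[p]) : PowerSeries ℤ_[p]) ^ k • Φ = 0 := by
  obtain ⟨P₁, hP₁, hne⟩ := hT
  have hsplit : W.HasSplitMultiplicativeReductionAtPrime p :=
    (Summit.BirchSwinnertonDyer.Rank1Residual.X11b.LocalTorsion.split_and_dvd_of_localTorsion_ne_zero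
      W p hp3 hmult P₁ hP₁ hne).1
  have hp2 : p ≠ 2 := by omega
  obtain ⟨he, hf⟩ := degreeOne_of_splitsIn hK.finrank_eq_two hs h𝔭
  exact tFlat_fLocal_anticyclotomic W p hK hp2 hsplit 𝔭 h𝔭 he hf κ hκ

end TFlat

end Summit.BirchSwinnertonDyer.BirchSwinnertonDyer.Theorems.LocalTorsionDegreeOne

end
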